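import Literature.Analysis.FluidPDE.StationaryEulerTwoStateWaveMeasure
import HarnessLib

/-!
# Stub `stub_pressurelessTwoState` — the two-state wave with the pressure (trace) bound
(crux `PointSink.PointFluxCone`, stmt-AnomalousDissipation-19033, line `Sketch`)

Lemma 4 of Choffrut–Székelyhidi 2014 (the tree's `StationaryEuler.exists_twoState`, files
`Literature/Analysis/FluidPDE/StationaryEulerTwoStateWave(Measure)`) for a unit-frequency
certificate `w̄`, with ONE extra conclusion when the certificate is trace free (`tr S̄ = 0`): the
trace `Σ_m S[φ]_{mm}` of the stress potential of the two-state wave `φ = χ · gₙ(⟪η, ·⟫)` is uniformly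
`≤ δ`.

Mechanism.  For a trace-free certificate the row contraction of the Kulkarni–Nomizu tensor is
`Σ_m Φ_{mkml} = S̄_{kl}/|η|²`, so `Σ_m S[φ]_{mm} = (S̄ : ∇²φ)/|η|²` (`pressurelessTwoState_trace`).
For `φ = χ · G(⟪η, ·⟫)` the cutoff expansion (`WaveCert.sum_sum_mul_pd_pd_mul`) gives
`(S̄ : ∇²φ) = (S̄ η · η) χ G'' + remTerm S̄ χ G`, and `S̄ η = 0`; the remainder term is bounded by
`(Σ |S̄_{kl}|) (M₂ K/M² + 2 M₁ K/M)` (`WaveCert.abs_remTerm_le`, `|gₙ| ≤ K/M²`, `|gₙ'| ≤ K/M`), which is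
small for the frequency parameter `n` large with the cutoff (`q`, hence `M₁`, `M₂`) fixed — the same
choice that makes the remainder of the field small in `exists_twoState`.

References: A. Choffrut, L. Székelyhidi Jr., *Weak solutions to the stationary incompressible
Euler equations*, SIAM J. Math. Anal. 46 (2014), Lemma 3, Lemma 4.
-/

noncomputable section

open scoped InnerProductSpace ContDiff ENNReal Topology
open Set Function MeasureTheory Metric Filter
open Literature.Analysis.FluidPDE Literature.Analysis.FluidPDE.StationaryEuler
open Literature.Analysis.FunctionSpaces

set_option linter.dupNamespace false

namespace Summit.AnomalousDissipation.AnomalousDissipation.Theorems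

/-! ## The trace identity for trace-free certificates -/

/-- Row contraction of the stress coefficient tensor `Φ` on its `(i, j)` diagonal:
`Σ_m Φ_{mkml} = (tr S̄ η_k η_l + S̄_{kl} |η|²)/|η|⁴`. [cite: ChoffrutSzekelyhidi2014, Lemma 3] -/
theorem pressurelessTwoState_sum_Φ_diag {d : Type*} [Fintype d] (c : WaveCert d) (k l : d) :
    ∑ m, c.Φ m k m l = (c.S.trace * c.η k * c.η l + c.S k l * ‖c.η‖ ^ 2) / (‖c.η‖ ^ 2) ^ 2 := by
  -- adapted from Summits/AnomalousDissipation/AnomalousDissipation/Cruxes/PointFluxCone/IdeatorK1SketchProofs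
  unfold WaveCert.Φ
  rw [← Finset.sum_div]
  congr 1
  have h1 : ∑ m, c.S k m * c.η m * c.η l = (∑ m, c.S k m * c.η m) * c.η l := by
    rw [Finset.sum_mul]
  have h2 : ∑ m, c.S m l * c.η k * c.η m = c.η k * ∑ m, c.η m * c.S m l := by
    rw [Finset.mul_sum]; exact Finset.sum_congr rfl fun m _ => by ring
  have h3 : ∑ m, c.S k l * c.η m * c.η m = c.S k l * ∑ m, c.η m ^ 2 := by
    rw [Finset.mul_sum]; exact Finset.sum_congr rfl fun m _ => by ring
  have h4 : ∑ m, c.S m m * c.η k * c.η l = c.S.trace * c.η k * c.η l := by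
    rw [Matrix.trace, Finset.sum_mul, Finset.sum_mul]; rfl
  simp only [Finset.sum_add_distrib, Finset.sum_sub_distrib, h1, h2, h3, h4, c.sum_S_η, c.sum_η_S,
    c.sum_η_sq]
  ring

/-- **The pressureless trace identity**: for a trace-free certificate (`tr S̄ = 0`),
`Σ_m S[φ]_{mm} = (S̄ : ∇²φ)/|η|²`. [cite: ChoffrutSzekelyhidi2014, Lemma 3] -/
theorem pressurelessTwoState_trace {d : Type*} [Fintype d] [DecidableEq d] (c : WaveCert d)
    (htr : c.S.trace = 0) (φ : Ed d → ℝ) (x : Ed d) :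
    ∑ m, c.strS φ m m x = (∑ k, ∑ l, c.S k l * pd (eb k) (pd (eb l) φ) x) / ‖c.η‖ ^ 2 := by
  -- adapted from Summits/AnomalousDissipation/AnomalousDissipation/Cruxes/PointFluxCone/IdeatorK1SketchProofs
  unfold WaveCert.strS
  rw [Finset.sum_comm]
  rw [Finset.sum_div]
  refine Finset.sum_congr rfl fun k _ => ?_
  rw [Finset.sum_comm, Finset.sum_div]
  refine Finset.sum_congr rfl fun l _ => ?_
  rw [← Finset.sum_mul, pressurelessTwoState_sum_Φ_diag, htr]
  have hη : (‖c.η‖ ^ 2) ≠ 0 := ne_of_gt c.normSq_pos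
  rw [zero_mul, zero_mul, zero_add, sq (‖c.η‖ ^ 2), mul_div_mul_right _ _ hη]
  ring

/-- `S̄ η · η = Σ_{k,l} S̄_{kl} η_k η_l = 0` for a certificate (`S̄ η = 0`). [folklore] -/
theorem pressurelessTwoState_sum_S_η_η {d : Type*} [Fintype d] (c : WaveCert d) :
    ∑ k, ∑ l, c.S k l * c.η k * c.η l = 0 := by
  refine Finset.sum_eq_zero fun k _ => ?_
  have : ∑ l, c.S k l * c.η k * c.η l = c.η k * ∑ l, c.S k l * c.η l := by
    rw [Finset.mul_sum]; exact Finset.sum_congr rfl fun l _ => by ring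
  rw [this, c.sum_S_η, mul_zero]

/-- **Trace of the stress potential of a cut-off plane wave**: for a trace-free certificate and
`φ = χ · G(⟪η, ·⟫)`, `Σ_m S[φ]_{mm}(x) = remTerm S̄ χ G (x) / |η|²` — the terms with both derivatives
on `G` drop out since `S̄ η = 0`. [cite: ChoffrutSzekelyhidi2014, Lemma 3, Lemma 4] -/
theorem pressurelessTwoState_trace_mul_comp_phase {d : Type*} [Fintype d] [DecidableEq d]
    (c : WaveCert d) (htr : c.S.trace = 0) {χ : Ed d → ℝ} {G : ℝ → ℝ} (hχ : ContDiff ℝ ∞ χ)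
    (hG : ContDiff ℝ ∞ G) (x : Ed d) :
    ∑ m, c.strS (fun y => χ y * G (phase c.η y)) m m x =
      c.remTerm (fun k l => c.S k l) χ G x / ‖c.η‖ ^ 2 := by
  rw [pressurelessTwoState_trace c htr, c.sum_sum_mul_pd_pd_mul hχ hG (fun k l => c.S k l) x,
    pressurelessTwoState_sum_S_η_η, zero_mul, zero_add]

/-- **The trace bound for the two-state wave**: with `M₁, M₂` bounds of `∇χ, ∇²χ` and `K` a bound
of the cell potential and its derivative,
`|Σ_m S[φₙ]_{mm}| ≤ (Σ_{kl} |S̄_{kl}|) (M₂ K/M² + 2 M₁ K/M)`. [cite: ChoffrutSzekelyhidi2014, Lemma 4] -/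
theorem pressurelessTwoState_abs_trace_le {d : Type*} [Fintype d] [DecidableEq d] [Nonempty d]
    (D : TwoStateData d) (htr : D.c.S.trace = 0) {M₁ M₂ K : ℝ}
    (hM₁ : ∀ k x, |pd (eb k) D.χ x| ≤ M₁) (hM₂ : ∀ k l x, |pd (eb k) (pd (eb l) D.χ) x| ≤ M₂)
    (hK0 : 0 ≤ K) (hK : ∀ θ, |D.p.cellPot θ| ≤ K ∧ |D.p.cellInt θ| ≤ K) (x : Ed d) :
    |∑ m, D.c.strS D.pot m m x| ≤
      (∑ k, ∑ l, |D.c.S k l|) * (M₂ * (K / (D.M : ℝ) ^ 2) + 2 * (M₁ * 1) * (K / D.M)) := by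
  -- adapted from Literature/Analysis/FluidPDE/StationaryEulerTwoStateWave (norm_rem_le)
  have h := D.c.abs_remTerm_le (fun k l => D.c.S k l) (χ := D.χ) (G := D.comb) (x := x)
    (B₁ := K / D.M) (fun k => hM₁ k x) (fun k l => hM₂ k l x)
    (D.abs_comb_le hK0 (fun θ => (hK θ).1) _)
    (by rw [D.deriv_comb]; exact D.abs_comb'_le hK0 (fun θ => (hK θ).2) _)
  rw [D.hη] at h
  unfold TwoStateData.pot
  rw [pressurelessTwoState_trace_mul_comp_phase D.c htr D.contDiff_χ D.contDiff_comb x, D.hη,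
    one_pow, div_one]
  exact h

/-- The stress potential of the zero potential has vanishing trace. [folklore] -/
theorem pressurelessTwoState_strS_zero {d : Type*} [Fintype d] [DecidableEq d] (c : WaveCert d)
    (i j : d) (x : Ed d) : c.strS (fun _ => 0) i j x = 0 := by
  unfold WaveCert.strS
  simp [WaveCert.pd_pd_eq_zero_of_notMem (show x ∉ tsupport (fun _ : Ed d => (0 : ℝ)) by simp)]

/-- The arithmetic of the choice of the frequency parameter: if `M ≥ 1` and
`C (A K + 2 B K)/δ < M` then `C (A K/M² + 2 B K/M) ≤ δ`. [folklore] -/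
theorem pressurelessTwoState_small {C A B K M δ : ℝ} (hC : 0 ≤ C) (hA : 0 ≤ A) (hK : 0 ≤ K)
    (hδ : 0 < δ) (hM1 : 1 ≤ M) (hn : C * (A * K + 2 * B * K) / δ < M) :
    C * (A * (K / M ^ 2) + 2 * (B * 1) * (K / M)) ≤ δ := by
  -- adapted from Literature/Analysis/FluidPDE/StationaryEulerTwoStateWaveMeasure (exists_twoState)
  have hMpos : 0 < M := by linarith
  have hKM : K / M ^ 2 ≤ K / M := div_le_div_of_nonneg_left hK hMpos (by nlinarith)
  have h1 : C * (A * (K / M ^ 2) + 2 * (B * 1) * (K / M)) ≤ C * (A * K + 2 * B * K) / M := by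
    have : C * (A * (K / M) + 2 * (B * 1) * (K / M)) = C * (A * K + 2 * B * K) / M := by
      field_simp
    rw [← this]
    gcongr
  have h2 : C * (A * K + 2 * B * K) / M ≤ δ := by
    rw [div_le_iff₀ hMpos]; rw [div_lt_iff₀ hδ] at hn; linarith
  exact h1.trans h2

/-! ## Lemma 4 with the trace bound -/

/-- **Lemma 4 with the pressure (trace) bound**, in any dimension: for a certificate `w̄` with unit
`η` and `tr S̄ = 0`, a coordinate `i₀`, `t ∈ [0, 1]` and `ε, δ > 0` there is a smooth potential `φ`
supported in the reference cube `B` of the Householder frame of `η` whose field `W = 𝓛_w̄[φ]` is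
`δ`-close to the segment `{θ w̄ : θ ∈ [-(1-t), t]}` everywhere, whose stress potential has trace
`≤ δ` everywhere, and which equals `-(1-t) w̄`, resp. `t w̄`, on disjoint open subsets `A_l, A_r ⊆ B`
of measure `≥ t - ε`, resp. `≥ (1-t) - ε`. [cite: ChoffrutSzekelyhidi2014, Lemma 4] -/
theorem pressurelessTwoState_exists {d : Type*} [Fintype d] [DecidableEq d] (c : WaveCert d)
    (hη : ‖c.η‖ = 1) (htr : c.S.trace = 0) (i₀ : d) {t : ℝ} (ht0 : 0 ≤ t) (ht1 : t ≤ 1) {ε δ : ℝ}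
    (hε : 0 < ε) (hδ : 0 < δ) :
    ∃ φ : Ed d → ℝ, ContDiff ℝ ∞ φ ∧ HasCompactSupport φ ∧ tsupport φ ⊆ refCube (houseR i₀ c.η) ∧
      (∀ x, ∃ θ ∈ Icc (-(1 - t)) t, ‖c.field φ x - θ • c.dir‖ ≤ δ) ∧
      (∀ x, |∑ m, c.strS φ m m x| ≤ δ) ∧
      ∃ Al Ar : Set (Ed d), IsOpen Al ∧ IsOpen Ar ∧ Al ⊆ refCube (houseR i₀ c.η) ∧
        Ar ⊆ refCube (houseR i₀ c.η) ∧ Disjoint Al Ar ∧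
        (∀ x ∈ Al, c.field φ x = (-(1 - t)) • c.dir) ∧ (∀ x ∈ Ar, c.field φ x = t • c.dir) ∧
        t - ε ≤ volume.real Al ∧ (1 - t) - ε ≤ volume.real Ar := by
  -- adapted from Literature/Analysis/FluidPDE/StationaryEulerTwoStateWaveMeasure (exists_twoState)
  haveI : Nonempty d := ⟨i₀⟩
  have hvolB : volume.real (refCube (houseR i₀ c.η)) = 1 := by
    rw [Measure.real, volume_refCube, ENNReal.toReal_one]
  have htr0 : ∀ x, |∑ m, c.strS (fun _ => (0 : ℝ)) m m x| ≤ δ := fun x => by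
    rw [Finset.sum_eq_zero fun m _ => pressurelessTwoState_strS_zero c m m x, abs_zero]
    exact hδ.le
  -- the degenerate weights
  rcases ht0.eq_or_lt with rfl | ht0'
  · refine ⟨fun _ => 0, contDiff_const, HasCompactSupport.zero, by simp, fun x => ⟨0, by simp, ?_⟩,
      htr0, ∅, refCube (houseR i₀ c.η), isOpen_empty, isOpen_refCube _, empty_subset _, subset_rfl,
      empty_disjoint _, fun x hx => hx.elim, fun x _ => ?_, by simp [hε.le], by rw [hvolB]; linarith⟩
    · rw [c.field_zero, zero_smul, sub_zero, norm_zero]; exact hδ.le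
    · rw [c.field_zero, zero_smul]
  rcases ht1.eq_or_lt with rfl | ht1'
  · refine ⟨fun _ => 0, contDiff_const, HasCompactSupport.zero, by simp, fun x => ⟨0, by simp, ?_⟩,
      htr0, refCube (houseR i₀ c.η), ∅, isOpen_refCube _, isOpen_empty, subset_rfl, empty_subset _,
      disjoint_empty _, fun x _ => ?_, fun x hx => hx.elim, by rw [hvolB]; linarith, by simp [hε.le]⟩
    · rw [c.field_zero, zero_smul, sub_zero, norm_zero]; exact hδ.le
    · rw [c.field_zero, sub_self, neg_zero, zero_smul]
  -- the parameters: waste `ε' = min (ε/4) (1/2)`, cutoff `q ≥ max 3 (4d/ε)`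
  set ε' : ℝ := min (ε / 4) (1 / 2) with hε'
  have hε'0 : 0 < ε' := lt_min (by linarith) (by norm_num)
  have hε'1 : ε' < 1 := (min_le_right _ _).trans_lt (by norm_num)
  have hε'4 : ε' ≤ ε / 4 := min_le_left _ _
  set p : Profile.CellData := ⟨t, ε', ht0', ht1', hε'0, hε'1⟩ with hp
  obtain ⟨q, hq⟩ := exists_nat_gt (max (3 : ℝ) (4 * Fintype.card d / ε))
  have hq3 : 3 ≤ q := by exact_mod_cast ((le_max_left _ _).trans hq.le)
  have hq3' : (3 : ℝ) ≤ q := by exact_mod_cast hq3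
  have hqpos : (0 : ℝ) < q := by linarith
  have hqε : 2 * (Fintype.card d : ℝ) / q ≤ ε / 2 := by
    have h := (le_max_right _ _).trans_lt hq
    rw [div_lt_iff₀ hε] at h
    rw [div_le_iff₀ hqpos]
    nlinarith
  -- the cutoff and the profile do not depend on `n`: bounds first, then `n`
  set D₀ : TwoStateData d := ⟨c, hη, i₀, p, q, hq3, 1, le_rfl⟩ with hD₀
  obtain ⟨M₁, M₂, hM₁, hM₂⟩ := exists_pd_bounds D₀.contDiff_χ D₀.hasCompactSupport_χ
  obtain ⟨K, hK0, hK⟩ := p.exists_bound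
  have hM₂0 : 0 ≤ M₂ := (abs_nonneg _).trans (hM₂ i₀ i₀ 0)
  -- the two constants: the remainder of the field and the trace
  set Cb : ℝ := c.coefBound * (M₂ * K + 2 * M₁ * K) with hCb
  set Cs : ℝ := (∑ k, ∑ l, |c.S k l|) * (M₂ * K + 2 * M₁ * K) with hCs
  have hcoef : 0 ≤ c.coefBound := by
    unfold WaveCert.coefBound
    exact add_nonneg (Finset.sum_nonneg fun _ _ => Finset.sum_nonneg fun _ _ => Finset.sum_nonneg
      fun _ _ => abs_nonneg _) (Finset.sum_nonneg fun _ _ => Finset.sum_nonneg fun _ _ =>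
      Finset.sum_nonneg fun _ _ => Finset.sum_nonneg fun _ _ => abs_nonneg _)
  have hScoef : 0 ≤ ∑ k, ∑ l, |c.S k l| :=
    Finset.sum_nonneg fun _ _ => Finset.sum_nonneg fun _ _ => abs_nonneg _
  obtain ⟨n, hn⟩ := exists_nat_gt (max (1 : ℝ) (max (Cb / δ) (Cs / δ)))
  have hn1 : 1 ≤ n := by exact_mod_cast ((le_max_left _ _).trans hn.le)
  set D : TwoStateData d := ⟨c, hη, i₀, p, q, hq3, n, hn1⟩ with hD
  have hχ : D.χ = D₀.χ := rfl
  have hMn : (n : ℝ) ≤ D.M := by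
    have : D.M = n * q := rfl
    rw [this, Nat.cast_mul]
    have : (1 : ℝ) ≤ q := by linarith
    nlinarith [(Nat.cast_nonneg n : (0 : ℝ) ≤ n)]
  have hM1 : (1 : ℝ) ≤ D.M := le_trans (by exact_mod_cast hn1) hMn
  -- the remainder bound
  have hrem : ∀ x, ‖c.rem D.χ D.comb x‖ ≤ δ := by
    intro x
    have h := D.norm_rem_le (M₁ := M₁) (M₂ := M₂) (K := K) (by rw [hχ]; exact hM₁)
      (by rw [hχ]; exact hM₂) hK0 hK x
    have hn' : Cb / δ < D.M :=
      (((le_max_left _ _).trans (le_max_right _ _)).trans_lt hn).trans_le hMn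
    exact h.trans (pressurelessTwoState_small hcoef hM₂0 hK0 hδ hM1 hn')
  -- the trace bound
  have htrace : ∀ x, |∑ m, c.strS D.pot m m x| ≤ δ := by
    intro x
    have h := pressurelessTwoState_abs_trace_le D htr (M₁ := M₁) (M₂ := M₂) (K := K)
      (by rw [hχ]; exact hM₁) (by rw [hχ]; exact hM₂) hK0 hK x
    have hn' : Cs / δ < D.M :=
      (((le_max_right _ _).trans (le_max_right _ _)).trans_lt hn).trans_le hMn
    exact h.trans (pressurelessTwoState_small hScoef hM₂0 hK0 hδ hM1 hn')
  refine ⟨D.pot, D.contDiff_pot, D.hasCompactSupport_pot, D.tsupport_pot_subset, fun x => ?_, htrace,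
    D.Aneg, D.Apos, D.isOpen_Aneg, D.isOpen_Apos, D.Aneg_subset, D.Apos_subset, D.disjoint_Aneg_Apos,
    fun x hx => D.W_eq_neg hx, fun x hx => D.W_eq_pos hx, ?_, ?_⟩
  · refine ⟨D.χ x * D.comb'' (phase c.η x), D.amp_mem_Icc x, ?_⟩
    have := D.W_eq x
    rw [TwoStateData.W] at this
    rw [this, add_sub_cancel_left]
    exact hrem x
  · have h := D.volume_real_Aneg_ge
    have : D.p.t = t := rfl
    have : D.p.ε = ε' := rfl
    have : (D.q : ℝ) = q := rfl
    linarith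
  · have h := D.volume_real_Apos_ge
    have : D.p.t = t := rfl
    have : D.p.ε = ε' := rfl
    have : (D.q : ℝ) = q := rfl
    linarith

/-- **PTS (Lemma 4 with pressure).** The tree's two-state wave `exists_twoState` for a unit-frequency
certificate in `ℝ³`, with one extra conclusion (used when the certificate is trace free, `tr S̄ = 0`,
which is a hypothesis here): the trace of the stress potential,
`Σ_m S[φ]_{mm} = (S̄ : ∇²φ)/|η|² = remTerm S̄ χ gₙ /|η|²` for `φ = χ · gₙ(⟪η, ·⟫)` (no `gₙ''` term since
`S̄ η = 0`), is uniformly `≤ δ`. [cite: ChoffrutSzekelyhidi2014, Lemma 3, Lemma 4] -/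
theorem stub_pressurelessTwoState :
    (∀ (c : WaveCert (Fin 3)), ‖c.η‖ = 1 → c.S.trace = 0 → ∀ (i₀ : Fin 3) (t : ℝ), 0 ≤ t → t ≤ 1 →
      ∀ (ε δ : ℝ), 0 < ε → 0 < δ →
        ∃ φ : Ed (Fin 3) → ℝ, ContDiff ℝ ∞ φ ∧ HasCompactSupport φ ∧
          tsupport φ ⊆ refCube (houseR i₀ c.η) ∧
          (∀ x, ∃ θ ∈ Icc (-(1 - t)) t, ‖c.field φ x - θ • c.dir‖ ≤ δ) ∧
          (∀ x, |∑ m, c.strS φ m m x| ≤ δ) ∧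
          ∃ Al Ar : Set (Ed (Fin 3)), IsOpen Al ∧ IsOpen Ar ∧ Al ⊆ refCube (houseR i₀ c.η) ∧
            Ar ⊆ refCube (houseR i₀ c.η) ∧ Disjoint Al Ar ∧
            (∀ x ∈ Al, c.field φ x = (-(1 - t)) • c.dir) ∧ (∀ x ∈ Ar, c.field φ x = t • c.dir) ∧
            t - ε ≤ volume.real Al ∧ (1 - t) - ε ≤ volume.real Ar) := by
  intro c hη htr i₀ t ht0 ht1 ε δ hε hδ
  exact pressurelessTwoState_exists c hη htr i₀ ht0 ht1 hε hδ

end Summit.AnomalousDissipation.AnomalousDissipation.Theorems
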